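import Mathlib
import Summits.CriticalPhenomena.CardyFormulaZ2.Theorems.CardySelfRefinementDefs
import Summits.CriticalPhenomena.CardyFormulaZ2.Theorems.CardySelfRefinementGradientComparabilityStubSlopeBoundsCornerPatterns
import Summits.CriticalPhenomena.CardyFormulaZ2.Theorems.CardySelfRefinementGradientComparabilityStubSlopeBoundsStageA
import HarnessLib

/-!
# Crux `GradientComparability` (stmt-CriticalPhenomena-10269), line `monotone-product-coordinates` —
# stub `stub_cornerLocalSlope` (LOC), penalty bound (A″_k), part 4: the bulk penalty of the corner
# dictionary, summed over the far bundles of the window, carries a factor `c`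

Route `CardySelfRefinement`, sub-problem `CriticalPhenomena/CardyFormulaZ2`; vocabulary from
`CardySelfRefinementDefs` (`ax tb M Aloc window edgeOf dirVec`); part 3 (`…StubSlopeBoundsCornerPatterns`:
`defect_le_of_far`, the per-bundle per-pattern bound) and `not_isPivotal_Aloc_of_notMem_window`
(`…StubSlopeBoundsStageA`).

## Mathematics

The exact corner dictionary `Drho_eq_sum_half_pivotal_sub_defect` reads, for the selector coins
`i = (t, d, 2)` of the coin window,
`∂ρP = Σ_i ( ½ M(PIV_i) − 2^{-k} Σ_{J ⊆ [k]} M(DEF_{i,J}) )`, `DEF_{i,J} = A_i^J ∖ A_i^∅`, `DEF_{i,[k]} = PIV_i`,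
`DEF_{i,∅} = ∅`.  Part 3 bounds each proper defect of a FAR bundle (interior canonical vertices
`k t + j e_d`, `0 < j < k`, at distance `≥ r ≥ 2η` from every quad side) by
`c · Σ_{0<j<k} (2/(1−c) M(PIV_i) + 2^{k+1} (M(g⁺_{i,j} pivotal) + M(g⁻_{i,j} pivotal)))`.  Here this is
summed over any finite set `S` of far selectors and over the `2^k − 1` proper patterns:

* `real_union_bundle_mem_le` — the forcing move of part 2 for an ARBITRARY measurable event:
  `M{ω ∪ B ∈ X} ≤ 2^{k+1} M(X)` (the "tying" move needed by the corner transfer (B″_k));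
* `canonical_vertex_inj` — `k t + j e_d = k t' + j' e_d` with `j, j' < k` forces `t = t'`, `j = j'`
  (reduce the `d`-coordinate mod `k`); hence the charged interior edges `g⁺_{i,j} = edgeOf (k t + j e_d, d')`,
  `g⁻_{i,j} = edgeOf (k t + j e_d − e_{d'}, d')` are each charged by at most one pair `(i, j)`;
* interior edges off the window are never pivotal (`not_isPivotal_Aloc_of_notMem_window`), the others
  are non-axial window edges, i.e. members of the Finset `Wn` of `stub_Dc_eq_sum_pivotal`
  (`∂cP = Σ_{e ∈ Wn} M(e pivotal)`);
* `sum_defect_le_of_far` (registered):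
  `Σ_{i ∈ S} Σ_{J ⊊ [k]} M(DEF_{i,J}) ≤ c · ( 2(k−1)(2^k−1)/(1−c) · Σ_{i ∈ S} M(PIV_i) + 2^{k+2}(2^k−1) · Σ_{e ∈ Wn} M(e pivotal) )`,
  valid for `0 < k`, any `ρ ∈ ℝ` (the corner `ρ = 1` included) and `0 ≤ c < 1`.

With `stub_Dc_eq_sum_pivotal` the last sum is `∂cP`, so on the bulk the penalty of the dictionary is
`2^{-k} PEN_bulk ≤ c · (C₁(k)/(1−c) · N_PIV + C₂(k) · ∂cP)` — the (A″_k) input of the signed domination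
(SD) behind the local corner slope bound, up to the boundary-layer bundles.
-/

noncomputable section

namespace Summit.CriticalPhenomena.CardyFormulaZ2.Theorems.CardySelfRefinement

open scoped Topology
open Filter Set MeasureTheory
open Literature.Probability.LatticeModels Literature.Probability.Percolation
open Literature.Probability.Percolation.QuadCrossing
open Summit.CriticalPhenomena.CardyFormulaZ2.Theses.CardySelfRefinement

/-! ## Forcing a bundle open inside an arbitrary event (the tying move of the corner transfer) -/

/-- **Forcing a bundle open costs at most `2^{k+1}`, for any measurable event** (generalises
`real_isPivotal_union_bundle_le`; the "tying" move of the corner transfer (B″_k)): for `0 < k`, any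
`ρ, c`, the bundle `B` of `(t, d)` and a measurable `X`, `M{ω | ω ∪ B ∈ X} ≤ 2^{k+1} · M(X)` — shared
coin ON and the `k` own coins ON open every sub-edge whatever the selector says, uniformly in `ρ`. -/
theorem real_union_bundle_mem_le {k : ℕ} (hk : 0 < k) (ρ c : ℝ) (t : Site 2) (d : Fin 2)
    {X : Set (BondConfig (Site 2))} (hX : MeasurableSet X) :
    (M k ρ c).real {ω | ω ∪ edgeOf '' {vd : Site 2 × Fin 2 | ax k vd ∧ tb k vd = t ∧ vd.2 = d} ∈ X} ≤
      2 ^ (k + 1) * (M k ρ c).real X := by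
  classical
  obtain ⟨hw₁, hw₂, hw₃⟩ := bundle_param_canonical hk t d
  set w : ℕ → Site 2 := fun j l => (k : ℤ) * t l + if l = d then (j : ℤ) else 0 with hw
  set B : Finset (Sym2 (Site 2)) := (Finset.range k).image fun j => edgeOf (w j, d) with hB
  have hBset := coe_bundleFinset_eq_image k (w := w) hw₁ hw₂ hB
  set C : Finset (Site 2 × Fin 2 × Fin 3) :=
    insert (t, d, (1 : Fin 3)) ((Finset.range k).image fun j => (w j, d, (0 : Fin 3))) with hC
  have hcfg : ∀ S : Set (Site 2 × Fin 2 × Fin 3), cfg k (S ∪ ↑C) = cfg k S ∪ ↑B := by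
    intro S
    have h := cfg_eq_of_agree_off_bundleCoins k hw₂ hw₃ hB (S := S) (S' := S ∪ ↑C)
      (fun x hx2 hx1 hx0 => ?_) (fun _ => True) (fun j hj => ?_)
    · rw [h, Finset.filter_true_of_mem fun _ _ => trivial, ← hB, Set.sdiff_union_self]
    · simp only [Set.mem_union, Finset.mem_coe, hC, Finset.mem_insert, Finset.mem_image, Finset.mem_range,
        or_iff_left_iff_imp]
      rintro (h1 | ⟨j, hj, rfl⟩)
      · exact absurd h1 hx1
      · exact absurd rfl (hx0 j hj)
    · refine (opn_subEdge k (w := w) (j := j) (hw₁ j hj) (S ∪ ↑C)).trans ?_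
      have hsh : (t, d, (1 : Fin 3)) ∈ S ∪ ↑C := Or.inr (by simp [hC])
      have hown : (w j, d, (0 : Fin 3)) ∈ S ∪ ↑C :=
        Or.inr (by simp only [hC, Finset.coe_insert, Finset.coe_image, Set.mem_insert_iff, Set.mem_image,
          Finset.mem_coe, Finset.mem_range]; exact Or.inr ⟨j, hj, rfl⟩)
      simp only [hsh, hown, and_true, iff_true]
      exact em _
  have hm : MeasurableSet {ω : BondConfig (Site 2) | ω ∪ ↑B ∈ X} :=
    (measurable_set_iff.2 fun x => (measurable_set_mem x).or measurable_const :
      Measurable fun ω : BondConfig (Site 2) => ω ∪ ↑B) hX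
  have hpre : (cfg k) ⁻¹' {ω : BondConfig (Site 2) | ω ∪ ↑B ∈ X} = {S | S ∪ ↑C ∈ (cfg k) ⁻¹' X} := by
    ext S
    simp only [Set.mem_preimage, Set.mem_setOf_eq, hcfg S]
  have hcard : C.card ≤ k + 1 := by
    rw [hC]
    refine (Finset.card_insert_le _ _).trans ?_
    simpa using Finset.card_image_le (s := Finset.range k) (f := fun j => (w j, d, (0 : Fin 3)))
  have hhalf : ∀ i ∈ C, (prm k ρ c i : ℝ) = 1 / 2 := by
    intro i hi
    simp only [hC, Finset.mem_insert, Finset.mem_image, Finset.mem_range] at hi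
    rcases hi with rfl | ⟨j, hj, rfl⟩
    · simp [prm]
    · have hax' : ax k (w j, d) := (hw₁ j hj).1
      simp [prm, hax']
  rw [← hBset, map_measureReal_apply (measurable_cfg k) hm, map_measureReal_apply (measurable_cfg k) hX, hpre]
  refine (prodBernoulli_real_union_le_two_pow (prm k ρ c) C hhalf (measurable_cfg k hX)).trans ?_
  have h0 : 0 ≤ (prodBernoulli (prm k ρ c)).real ((cfg k) ⁻¹' X) := measureReal_nonneg
  exact mul_le_mul_of_nonneg_right (pow_le_pow_right₀ (by norm_num) hcard) h0

/-! ## Summing over the far bundles of the window -/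

/-- **Canonical interior vertices determine their bundle.**  If `0 < j, j' < k` and
`k t + j e_d = k t' + j' e_d`, then `t = t'` and `j = j'`. -/
theorem canonical_vertex_inj {k : ℕ} (hk : 0 < k) {t t' : Site 2} {d : Fin 2} {j j' : ℕ} (hj : j < k) (hj' : j' < k)
    (h : (fun l => (k : ℤ) * t l + if l = d then (j : ℤ) else 0) = fun l => (k : ℤ) * t' l + if l = d then (j' : ℤ) else 0) :
    t = t' ∧ j = j' := by
  have hk0 : (k : ℤ) ≠ 0 := by exact_mod_cast hk.ne'
  have hd := congrFun h d
  simp only [if_true] at hd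
  have hjj : (j : ℤ) = j' := by
    have h1 : ((j : ℤ) + (k : ℤ) * t d) % (k : ℤ) = (j : ℤ) := by
      rw [Int.add_mul_emod_self_left, Int.emod_eq_of_lt (by positivity) (by exact_mod_cast hj)]
    have h2 : ((j' : ℤ) + (k : ℤ) * t' d) % (k : ℤ) = (j' : ℤ) := by
      rw [Int.add_mul_emod_self_left, Int.emod_eq_of_lt (by positivity) (by exact_mod_cast hj')]
    rw [← h1, ← h2, add_comm, hd, add_comm]
  refine ⟨funext fun l => ?_, by exact_mod_cast hjj⟩
  have hl := congrFun h l
  by_cases hld : l = d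
  · subst hld
    simp only [if_true, hjj, add_left_inj] at hl
    exact mul_left_cancel₀ hk0 hl
  · simp only [if_neg hld, add_zero] at hl
    exact mul_left_cancel₀ hk0 hl

/-- **The bulk penalty of the corner dictionary carries a factor `c`** (registered helper of
`stub_cornerLocalSlope`; `defect_le_of_far` summed).  For `0 < k`, `0 < η`, `2η ≤ r`, any `ρ`,
`0 ≤ c < 1`, the non-axial window edges `Wn` (as in `stub_Dc_eq_sum_pivotal`) and any finite set `S`
of SELECTOR coins `(t, d, 2)` whose bundles have all interior canonical vertices `k t + j e_d`
(`0 < j < k`) drawn `r`-far from every quad side: the sum over `S` and over the proper patterns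
`J ⊊ [k]` of the defects `M(A^J ∖ A^∅)` is at most
`c · ( 2(k−1)(2^k−1)/(1−c) · Σ_S M(bundle set-pivotal) + 2^{k+2}(2^k−1) · Σ_{e ∈ Wn} M(e pivotal) )`.
(Each interior edge is the "upper"/"lower" edge at an interior vertex of at most one bundle:
`canonical_vertex_inj`; interior edges off the window are never pivotal.)  With
`Drho_eq_sum_half_pivotal_sub_defect` and `stub_Dc_eq_sum_pivotal` this is the bulk part of the
penalty bound (A″_k): `2^{-k} PEN_bulk ≤ c · (C₁(k)/(1−c) · N_PIV + C₂(k) · ∂cP)`. -/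
theorem sum_defect_le_of_far : ∀ (k m : ℕ), 0 < k → ∀ (F : Fin m → Quad (Set.univ : Set ℂ)) (η r : ℝ), 0 < η → 2 * η ≤ r → ∀ (ρ c : ℝ), c ∈ Set.Ico (0 : ℝ) 1 → ∀ (Wn : Finset (Sym2 (Site 2))), (∀ e, e ∈ Wn ↔ e ∈ window m F η ∧ ∃ (v : Site 2) (d : Fin 2), e = edgeOf (v, d) ∧ ¬ ax k (v, d)) → ∀ (S : Finset (Site 2 × Fin 2 × Fin 3)), (∀ i ∈ S, i.2.2 = 2) → (∀ i ∈ S, ∀ j : ℕ, 0 < j → j < k → ∀ (a : Fin m) (b : Fin 4), ∀ p ∈ (F a).side b, r ≤ dist ((η : ℂ) * squareLatticeEmbedding.z (fun l => (k : ℤ) * i.1 l + if l = i.2.1 then (j : ℤ) else 0)) p) → ∑ i ∈ S, ∑ J ∈ ((Finset.range k).powerset).erase (Finset.range k), (M k ρ c).real ({ω | ω \ edgeOf '' {vd : Site 2 × Fin 2 | ax k vd ∧ tb k vd = i.1 ∧ vd.2 = i.2.1} ∪ ↑(J.image fun j : ℕ => edgeOf ((fun l => (k : ℤ) * i.1 l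 + if l = i.2.1 then (j : ℤ) else 0), i.2.1)) ∈ Aloc m F η} \ {ω | ω \ edgeOf '' {vd : Site 2 × Fin 2 | ax k vd ∧ tb k vd = i.1 ∧ vd.2 = i.2.1} ∈ Aloc m F η}) ≤ c * (2 * ((k : ℝ) - 1) * (2 ^ k - 1) / (1 - c) * ∑ i ∈ S, (M k ρ c).real {ω | ω ∪ edgeOf '' {vd : Site 2 × Fin 2 | ax k vd ∧ tb k vd = i.1 ∧ vd.2 = i.2.1} ∈ Aloc m F η ∧ ω \ edgeOf '' {vd : Site 2 × Fin 2 | ax k vd ∧ tb k vd = i.1 ∧ vd.2 = i.2.1} ∉ Aloc m F η} + 2 ^ (k + 2) * (2 ^ k - 1) * ∑ e ∈ Wn, (M k ρ c).real {ω | IsPivotal (Aloc m F η) e ω}) := by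
  intro k m hk F η r hη hηr ρ c hc Wn hWn S hS2 hfar
  classical
  haveI := isProbabilityMeasure_M k ρ c
  -- abbreviations
  set dp : Fin 2 → Fin 2 := fun d => if d = 0 then 1 else 0 with hdp
  have hdp_ne : ∀ d : Fin 2, dp d ≠ d := by intro d; fin_cases d <;> decide
  have hdp_inj : ∀ d₁ d₂ : Fin 2, dp d₁ = dp d₂ → d₁ = d₂ := by
    intro d₁ d₂; fin_cases d₁ <;> fin_cases d₂ <;> decide
  set w : (Site 2 × Fin 2 × Fin 3) → ℕ → Site 2 :=
    fun i j l => (k : ℤ) * i.1 l + if l = i.2.1 then (j : ℤ) else 0 with hw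
  set piv : Sym2 (Site 2) → ℝ := fun e => (M k ρ c).real {ω | IsPivotal (Aloc m F η) e ω} with hpiv
  set PIV : (Site 2 × Fin 2 × Fin 3) → ℝ := fun i => (M k ρ c).real {ω | ω ∪ edgeOf '' {vd : Site 2 × Fin 2 |
      ax k vd ∧ tb k vd = i.1 ∧ vd.2 = i.2.1} ∈ Aloc m F η ∧
    ω \ edgeOf '' {vd : Site 2 × Fin 2 | ax k vd ∧ tb k vd = i.1 ∧ vd.2 = i.2.1} ∉ Aloc m F η} with hPIV
  set Gp : (Site 2 × Fin 2 × Fin 3) × ℕ → Sym2 (Site 2) := fun p => edgeOf (w p.1 p.2, dp p.1.2.1) with hGp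
  set Gm : (Site 2 × Fin 2 × Fin 3) × ℕ → Sym2 (Site 2) :=
    fun p => edgeOf (w p.1 p.2 - dirVec (dp p.1.2.1), dp p.1.2.1) with hGm
  have hpiv0 : ∀ e, 0 ≤ piv e := fun e => measureReal_nonneg
  have hPIV0 : ∀ i, 0 ≤ PIV i := fun i => measureReal_nonneg
  -- Steps 1–2: each far selector, each proper pattern
  have h12 : ∀ i ∈ S, ∑ J ∈ ((Finset.range k).powerset).erase (Finset.range k),
      (M k ρ c).real ({ω | ω \ edgeOf '' {vd : Site 2 × Fin 2 | ax k vd ∧ tb k vd = i.1 ∧ vd.2 = i.2.1} ∪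
          ↑(J.image fun j : ℕ => edgeOf (w i j, i.2.1)) ∈ Aloc m F η} \
        {ω | ω \ edgeOf '' {vd : Site 2 × Fin 2 | ax k vd ∧ tb k vd = i.1 ∧ vd.2 = i.2.1} ∈ Aloc m F η}) ≤
      (2 ^ k - 1) * (c * ∑ j ∈ Finset.Ioo 0 k, (2 / (1 - c) * PIV i +
        2 ^ (k + 1) * (piv (Gp (i, j)) + piv (Gm (i, j))))) := by
    intro i hi
    have hb : ∀ J ∈ ((Finset.range k).powerset).erase (Finset.range k),
        (M k ρ c).real ({ω | ω \ edgeOf '' {vd : Site 2 × Fin 2 | ax k vd ∧ tb k vd = i.1 ∧ vd.2 = i.2.1} ∪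
            ↑(J.image fun j : ℕ => edgeOf (w i j, i.2.1)) ∈ Aloc m F η} \
          {ω | ω \ edgeOf '' {vd : Site 2 × Fin 2 | ax k vd ∧ tb k vd = i.1 ∧ vd.2 = i.2.1} ∈ Aloc m F η}) ≤
        c * ∑ j ∈ Finset.Ioo 0 k, (2 / (1 - c) * PIV i + 2 ^ (k + 1) * (piv (Gp (i, j)) + piv (Gm (i, j)))) :=
      fun J hJ => defect_le_of_far k m hk F η r hη hηr i.1 i.2.1 (dp i.2.1) (hdp_ne _) (hfar i hi) ρ c hc J
        (Finset.mem_of_mem_erase hJ) (Finset.ne_of_mem_erase hJ)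
    refine (Finset.sum_le_sum hb).trans (le_of_eq ?_)
    rw [Finset.sum_const, Finset.card_erase_of_mem (Finset.mem_powerset_self _), Finset.card_powerset,
      Finset.card_range, nsmul_eq_mul, Nat.cast_sub Nat.one_le_two_pow]
    push_cast
    ring
  -- Step 3: the edges `Gp`, `Gm` are charged at most once each
  have hwinj : ∀ p ∈ S ×ˢ Finset.Ioo 0 k, ∀ q ∈ S ×ˢ Finset.Ioo 0 k,
      w p.1 p.2 = w q.1 q.2 → p.1.2.1 = q.1.2.1 → p = q := by
    rintro ⟨i, j⟩ hp ⟨i', j'⟩ hq hwe hde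
    simp only [Finset.mem_product, Finset.mem_Ioo] at hp hq
    simp only at hwe hde
    have hwe' : (fun l => (k : ℤ) * i.1 l + if l = i.2.1 then (j : ℤ) else 0) =
        fun l => (k : ℤ) * i'.1 l + if l = i.2.1 then (j' : ℤ) else 0 := by
      have h' := hwe
      simp only [hw] at h'
      rw [← hde] at h'
      exact h'
    obtain ⟨ht, hj⟩ := canonical_vertex_inj hk hp.2.2 hq.2.2 hwe'
    have hi : i = i' := Prod.ext ht (Prod.ext hde (by rw [hS2 _ hp.1, hS2 _ hq.1]))
    subst hi
    subst hj
    rfl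
  have hGp_inj : Set.InjOn Gp ↑(S ×ˢ Finset.Ioo 0 k) := by
    intro p hp q hq h
    have h' := edgeOf_injective h
    rw [Prod.mk.injEq] at h'
    exact hwinj p hp q hq h'.1 (hdp_inj _ _ h'.2)
  have hGm_inj : Set.InjOn Gm ↑(S ×ˢ Finset.Ioo 0 k) := by
    intro p hp q hq h
    have h' := edgeOf_injective h
    rw [Prod.mk.injEq] at h'
    have hde := hdp_inj _ _ h'.2
    refine hwinj p hp q hq ?_ hde
    have h1 := h'.1
    rwa [hde, sub_left_inj] at h1
  -- interior edges off the window are never pivotal; the others are in `Wn`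
  have hcharge : ∀ G : (Site 2 × Fin 2 × Fin 3) × ℕ → Sym2 (Site 2),
      Set.InjOn G ↑(S ×ˢ Finset.Ioo 0 k) →
      (∀ p ∈ S ×ˢ Finset.Ioo 0 k, ∃ (v : Site 2) (d : Fin 2), G p = edgeOf (v, d) ∧ ¬ ax k (v, d)) →
      ∑ p ∈ S ×ˢ Finset.Ioo 0 k, piv (G p) ≤ ∑ e ∈ Wn, piv e := by
    intro G hG hGax
    rw [← Finset.sum_image hG, ← Finset.sum_filter_add_sum_filter_not _ (· ∈ Wn)]
    have hzero : ∑ e ∈ ((S ×ˢ Finset.Ioo 0 k).image G).filter (fun e => ¬ e ∈ Wn), piv e = 0 := by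
      refine Finset.sum_eq_zero fun e he => ?_
      obtain ⟨he, heW⟩ := Finset.mem_filter.1 he
      obtain ⟨p, hp, rfl⟩ := Finset.mem_image.1 he
      obtain ⟨v, d, hGe, hax⟩ := hGax p hp
      have hnot : G p ∉ window m F η := fun hw' => heW ((hWn _).2 ⟨hw', v, d, hGe, hax⟩)
      have hset : {ω : BondConfig (Site 2) | IsPivotal (Aloc m F η) (G p) ω} = ∅ :=
        Set.eq_empty_of_forall_notMem fun ω hω => not_isPivotal_Aloc_of_notMem_window m F η hnot ω hω
      simp only [hpiv, hset, measureReal_empty]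
    rw [hzero, add_zero]
    exact Finset.sum_le_sum_of_subset_of_nonneg (fun e he => (Finset.mem_filter.1 he).2) fun e _ _ => hpiv0 e
  -- non-axiality of the charged edges
  have hcoord : ∀ d : Fin 2, (if dp d = 0 then (1 : Fin 2) else 0) = d := by
    intro d; fin_cases d <;> decide
  have hndvd : ∀ (i : Site 2 × Fin 2 × Fin 3) (j : ℕ), 0 < j → j < k → ¬ (k : ℤ) ∣ k * i.1 i.2.1 + j := by
    intro i j hj0 hjk h
    have h' : (k : ℤ) ∣ (j : ℤ) := by
      obtain ⟨q, hq⟩ := h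
      exact ⟨q - i.1 i.2.1, by rw [mul_sub]; linarith⟩
    have := Int.le_of_dvd (by exact_mod_cast hj0) h'
    omega
  have hwd : ∀ (i : Site 2 × Fin 2 × Fin 3) (j : ℕ), w i j i.2.1 = k * i.1 i.2.1 + j := fun i j => by simp [hw]
  have hGp_ax : ∀ p ∈ S ×ˢ Finset.Ioo 0 k, ∃ (v : Site 2) (d : Fin 2), Gp p = edgeOf (v, d) ∧ ¬ ax k (v, d) := by
    rintro ⟨i, j⟩ hp
    simp only [Finset.mem_product, Finset.mem_Ioo] at hp
    refine ⟨w i j, dp i.2.1, rfl, ?_⟩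
    show ¬ (k : ℤ) ∣ w i j (if dp i.2.1 = 0 then 1 else 0)
    rw [hcoord, hwd]
    exact hndvd i j hp.2.1 hp.2.2
  have hGm_ax : ∀ p ∈ S ×ˢ Finset.Ioo 0 k, ∃ (v : Site 2) (d : Fin 2), Gm p = edgeOf (v, d) ∧ ¬ ax k (v, d) := by
    rintro ⟨i, j⟩ hp
    simp only [Finset.mem_product, Finset.mem_Ioo] at hp
    refine ⟨w i j - dirVec (dp i.2.1), dp i.2.1, rfl, ?_⟩
    show ¬ (k : ℤ) ∣ (w i j - dirVec (dp i.2.1)) (if dp i.2.1 = 0 then 1 else 0)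
    have hdv : ∀ e : Fin 2, (dirVec e : Site 2) = Pi.single e 1 := fun e => dirVec_eq_single e
    rw [hcoord, Pi.sub_apply, hdv, Pi.single_apply, if_neg (Ne.symm (hdp_ne _)), hwd, sub_zero]
    exact hndvd i j hp.2.1 hp.2.2
  have hp_le := hcharge Gp hGp_inj hGp_ax
  have hm_le := hcharge Gm hGm_inj hGm_ax
  rw [Finset.sum_product] at hp_le hm_le
  -- Step 4: sum over the far selectors
  have hk1 : (1 : ℝ) ≤ k := by exact_mod_cast hk
  have hcard : ((Finset.Ioo 0 k).card : ℝ) = k - 1 := by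
    rw [Nat.card_Ioo, Nat.sub_zero, Nat.cast_sub (Nat.succ_le_of_lt hk), Nat.cast_one]
  have inner : ∀ i : Site 2 × Fin 2 × Fin 3,
      ∑ j ∈ Finset.Ioo 0 k, (2 / (1 - c) * PIV i + 2 ^ (k + 1) * (piv (Gp (i, j)) + piv (Gm (i, j)))) =
        (k - 1) * (2 / (1 - c) * PIV i) +
          2 ^ (k + 1) * (∑ j ∈ Finset.Ioo 0 k, piv (Gp (i, j)) + ∑ j ∈ Finset.Ioo 0 k, piv (Gm (i, j))) := by
    intro i
    rw [Finset.sum_add_distrib, Finset.sum_const, nsmul_eq_mul, hcard, ← Finset.mul_sum, Finset.sum_add_distrib]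
  have h2k : (0 : ℝ) ≤ 2 ^ k - 1 := by have : (1:ℝ) ≤ 2 ^ k := one_le_pow₀ (by norm_num); linarith
  calc ∑ i ∈ S, ∑ J ∈ ((Finset.range k).powerset).erase (Finset.range k),
        (M k ρ c).real ({ω | ω \ edgeOf '' {vd : Site 2 × Fin 2 | ax k vd ∧ tb k vd = i.1 ∧ vd.2 = i.2.1} ∪
            ↑(J.image fun j : ℕ => edgeOf (w i j, i.2.1)) ∈ Aloc m F η} \
          {ω | ω \ edgeOf '' {vd : Site 2 × Fin 2 | ax k vd ∧ tb k vd = i.1 ∧ vd.2 = i.2.1} ∈ Aloc m F η})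
      ≤ ∑ i ∈ S, (2 ^ k - 1) * (c * ∑ j ∈ Finset.Ioo 0 k, (2 / (1 - c) * PIV i +
          2 ^ (k + 1) * (piv (Gp (i, j)) + piv (Gm (i, j))))) := Finset.sum_le_sum h12
    _ = (2 ^ k - 1) * c * ((k - 1) * (2 / (1 - c)) * ∑ i ∈ S, PIV i +
          2 ^ (k + 1) * (∑ i ∈ S, ∑ j ∈ Finset.Ioo 0 k, piv (Gp (i, j)) +
            ∑ i ∈ S, ∑ j ∈ Finset.Ioo 0 k, piv (Gm (i, j)))) := by
        rw [← Finset.mul_sum, ← Finset.mul_sum, Finset.sum_congr rfl fun i _ => inner i]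
        simp only [Finset.sum_add_distrib, ← Finset.mul_sum]
        ring
    _ ≤ (2 ^ k - 1) * c * ((k - 1) * (2 / (1 - c)) * ∑ i ∈ S, PIV i +
          2 ^ (k + 1) * (∑ e ∈ Wn, piv e + ∑ e ∈ Wn, piv e)) := by
        have hc' : 0 ≤ (2 ^ k - 1) * c := mul_nonneg h2k hc.1
        gcongr
    _ = c * (2 * ((k : ℝ) - 1) * (2 ^ k - 1) / (1 - c) * ∑ i ∈ S, PIV i +
          2 ^ (k + 2) * (2 ^ k - 1) * ∑ e ∈ Wn, piv e) := by ring

end Summit.CriticalPhenomena.CardyFormulaZ2.Theorems.CardySelfRefinement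

end
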